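/-
Copyright (c) 2026. All rights reserved.
Released under Apache 2.0 license as described in the file LICENSE.
-/
import Summits.AtomisticToContinuum.Crystallization.Theorems.ChartedZeroExcessLayeredLatticeLiouvilleVL

/-!
# ChartedZeroExcessLayeredLatticeLiouville — part VM «WindowInverse I»: coercive block operators on a finite layer window — the Lax–Milgram solve and the
  Agmon / Combes–Thomas weighted coercivity (decomp-a2c-lens-2, g57; helper of stmt-AtomisticToContinuum-26636, leaf (LD′) `ModalLipschitzZ`;
  the analytic engine of bricks (3) mode extraction and (4b) inversion, critic rows 923 (iv) / 929 (b))

Abstract in a block family `B : ℤ → ℤ → (E3 →L[ℝ] E3)` and a window `W : Finset ℤ`; the chain instantiation (`B` = the flux operator on nearest-layer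
increments, coercivity constant `δ = 2κ₀ − ε` from VL `chainCoercive_of_coerciveZ`, weighted row sums from the Lennard-Jones decay) is a later part.
* VM.1 `blockApply B W d m = Σ_{n ∈ W} B m n (d n)` and its linearity;
* VM.2 ★ WINDOW SOLVE (finite-dimensional Lax–Milgram): under `δ`-COERCIVITY ON `W` (`δ·Σ_{m ∈ W} ‖d m‖² ≤ Σ_{m ∈ W} ⟪d m, blockApply B W d m⟫` for every
  field `d`, `δ > 0`) the window system `blockApply B W d = h` on `W`, `d = 0` off `W`, has exactly one solution (`window_exists` via Mathlib
  `LinearMap.injective_iff_surjective` on the finite-dimensional space `↥W → E3`; `window_unique`);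
* VM.3 ★ WEIGHTED COERCIVITY (the Agmon / Combes–Thomas commutator estimate): for weights `η > 0` with `|η m − η n| ≤ θ(|m − n|)·η n` and weighted
  row / column sums `Σ_n θ(|m − n|)·‖B m n‖ ≤ Λ` one has `(δ − Λ)·Σ_{m ∈ W} (η m‖d m‖)² ≤ Σ_{m ∈ W} η m²·⟪d m, blockApply B W d m⟫`
  (`weighted_coercive`) — no band and no rate is built in: exponential weights serve banded blocks, polynomial weights serve polynomially decaying
  blocks (the `ϱ`-uniform Lennard-Jones case, where the band `⌊ϱ/c⌋` may not enter the constants).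
Part VN draws the localised inverse bounds and the admissible weight profiles from these.
-/

namespace Summit.AtomisticToContinuum.Crystallization.Theorems.ChartedZeroExcessLayeredLatticeLiouville

open Summit.AtomisticToContinuum.Crystallization.Theorems.ChartedPlanarOrderRigidityDoor (E3)
open Finset
open scoped InnerProductSpace RealInnerProductSpace BigOperators

noncomputable section WindowInverse

variable {W : Finset ℤ} {B : ℤ → ℤ → (E3 →L[ℝ] E3)} {δ Λ : ℝ}

/-! ### VM.1  Block operators compressed to a layer window -/

/-- the block operator of the family `B` compressed to the window `W`: `(B_W d)(m) = Σ_{n ∈ W} B m n (d n)` (only the window values of `d` enter).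
[this file, g57] -/
def blockApply (B : ℤ → ℤ → (E3 →L[ℝ] E3)) (W : Finset ℤ) (d : ℤ → E3) (m : ℤ) : E3 :=
  ∑ n ∈ W, B m n (d n)

/-- additivity of the compressed block operator in the field. [formal bookkeeping] -/
theorem blockApply_add (B : ℤ → ℤ → (E3 →L[ℝ] E3)) (W : Finset ℤ) (d e : ℤ → E3) (m : ℤ) :
    blockApply B W (d + e) m = blockApply B W d m + blockApply B W e m := by
  simp only [blockApply, Pi.add_apply, map_add, sum_add_distrib]

/-- the compressed block operator respects differences. [formal bookkeeping] -/
theorem blockApply_sub (B : ℤ → ℤ → (E3 →L[ℝ] E3)) (W : Finset ℤ) (d e : ℤ → E3) (m : ℤ) :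
    blockApply B W (d - e) m = blockApply B W d m - blockApply B W e m := by
  simp only [blockApply, Pi.sub_apply, map_sub, sum_sub_distrib]

/-- homogeneity of the compressed block operator. [formal bookkeeping] -/
theorem blockApply_smul (B : ℤ → ℤ → (E3 →L[ℝ] E3)) (W : Finset ℤ) (r : ℝ) (d : ℤ → E3) (m : ℤ) :
    blockApply B W (r • d) m = r • blockApply B W d m := by
  simp only [blockApply, Pi.smul_apply, map_smul, smul_sum]

/-- the compressed block operator of a finite sum of fields. [formal bookkeeping] -/
theorem blockApply_sum {ι : Type*} (B : ℤ → ℤ → (E3 →L[ℝ] E3)) (W : Finset ℤ) (s : Finset ι) (d : ι → ℤ → E3) (m : ℤ) :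
    blockApply B W (∑ i ∈ s, d i) m = ∑ i ∈ s, blockApply B W (d i) m := by
  simp only [blockApply, Finset.sum_apply, map_sum]
  exact sum_comm

/-! ### VM.2  The window solve: coercivity gives a unique solution (finite-dimensional Lax–Milgram) -/

/-- ★ coercivity forces uniqueness: a field supported in `W` whose compressed image vanishes on `W` is zero. [this file, g57] -/
theorem eq_zero_of_blockApply_eq_zero (hδ : 0 < δ)
    (hco : ∀ d : ℤ → E3, δ * ∑ m ∈ W, ‖d m‖ ^ 2 ≤ ∑ m ∈ W, ⟪d m, blockApply B W d m⟫_ℝ)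
    {d : ℤ → E3} (hd : ∀ m, m ∉ W → d m = 0) (h : ∀ m ∈ W, blockApply B W d m = 0) : d = 0 := by
  have hsum : δ * ∑ m ∈ W, ‖d m‖ ^ 2 ≤ 0 := by
    refine (hco d).trans_eq (sum_eq_zero fun m hm => ?_)
    rw [h m hm, inner_zero_right]
  have hle : ∑ m ∈ W, ‖d m‖ ^ 2 ≤ 0 := by
    rw [← mul_zero δ] at hsum
    exact le_of_mul_le_mul_left hsum hδ
  have hall := (sum_eq_zero_iff_of_nonneg fun m _ => sq_nonneg ‖d m‖).mp (le_antisymm hle (sum_nonneg fun m _ => sq_nonneg _))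
  funext m
  by_cases hm : m ∈ W
  · have := hall m hm
    rwa [sq_eq_zero_iff, norm_eq_zero] at this
  · exact hd m hm

/-- ★ UNIQUENESS of the window solve: two fields supported in `W` with the same compressed image on `W` coincide. [this file, g57] -/
theorem window_unique (hδ : 0 < δ)
    (hco : ∀ d : ℤ → E3, δ * ∑ m ∈ W, ‖d m‖ ^ 2 ≤ ∑ m ∈ W, ⟪d m, blockApply B W d m⟫_ℝ)
    {d e : ℤ → E3} (hd : ∀ m, m ∉ W → d m = 0) (he : ∀ m, m ∉ W → e m = 0)
    (h : ∀ m ∈ W, blockApply B W d m = blockApply B W e m) : d = e := by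
  have := eq_zero_of_blockApply_eq_zero hδ hco (d := d - e) (fun m hm => by rw [Pi.sub_apply, hd m hm, he m hm, sub_zero])
    (fun m hm => by rw [blockApply_sub, h m hm, sub_self])
  exact sub_eq_zero.mp this

/-- ★ EXISTENCE of the window solve (Lax–Milgram on the finite-dimensional space `↥W → E3`): a coercive compressed block operator is injective on the
fields supported in `W`, hence — `LinearMap.injective_iff_surjective` — onto: every right-hand side `h` is attained on `W`. [this file, g57] -/
theorem window_exists (hδ : 0 < δ)
    (hco : ∀ d : ℤ → E3, δ * ∑ m ∈ W, ‖d m‖ ^ 2 ≤ ∑ m ∈ W, ⟪d m, blockApply B W d m⟫_ℝ) (h : ℤ → E3) :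
    ∃ d : ℤ → E3, (∀ m, m ∉ W → d m = 0) ∧ ∀ m ∈ W, blockApply B W d m = h m := by
  let ext : (W → E3) → ℤ → E3 := fun e m => if hm : m ∈ W then e ⟨m, hm⟩ else 0
  have hext0 : ∀ (e : W → E3) (m : ℤ), m ∉ W → ext e m = 0 := fun e m hm => dif_neg hm
  have hextW : ∀ (e : W → E3) (m : W), ext e m = e m := fun e m => by
    show (if hm : (m : ℤ) ∈ W then e ⟨m, hm⟩ else 0) = e m
    rw [dif_pos m.2]
  have hext_add : ∀ e e' : W → E3, ext (e + e') = ext e + ext e' := fun e e' => by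
    funext n
    by_cases hn : n ∈ W
    · simp only [ext, dif_pos hn, Pi.add_apply]
    · simp only [ext, dif_neg hn, Pi.add_apply, add_zero]
  have hext_smul : ∀ (r : ℝ) (e : W → E3), ext (r • e) = r • ext e := fun r e => by
    funext n
    by_cases hn : n ∈ W
    · simp only [ext, dif_pos hn, Pi.smul_apply]
    · simp only [ext, dif_neg hn, Pi.smul_apply, smul_zero]
  let L : (W → E3) →ₗ[ℝ] (W → E3) :=
    { toFun := fun e m => blockApply B W (ext e) m
      map_add' := fun e e' => by
        funext m
        rw [hext_add, blockApply_add]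
        rfl
      map_smul' := fun r e => by
        funext m
        rw [hext_smul, blockApply_smul]
        rfl }
  have hinj : Function.Injective L := by
    refine (injective_iff_map_eq_zero L).mpr fun e hLe => ?_
    have hz : ext e = 0 := eq_zero_of_blockApply_eq_zero hδ hco (hext0 e) fun m hm => congrFun hLe ⟨m, hm⟩
    funext m
    rw [← hextW e m, hz]
    rfl
  obtain ⟨e, he⟩ := (LinearMap.injective_iff_surjective.mp hinj) (fun m => h m)
  exact ⟨ext e, hext0 e, fun m hm => congrFun he ⟨m, hm⟩⟩

/-! ### VM.3  Weighted coercivity: the Agmon / Combes–Thomas commutator estimate -/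

/-- ★ WEIGHTED COERCIVITY.  If `B` is `δ`-coercive on `W`, the positive weights `η` vary slowly at the scale of the blocks — `|η m − η n| ≤ θ(|m−n|)·η n`
with weighted row and column sums `Σ_n θ(|m−n|)·‖B m n‖ ≤ Λ` — then testing the window image against `η²·d` still controls the weighted energy:
`(δ − Λ)·Σ_{m ∈ W} (η m·‖d m‖)² ≤ Σ_{m ∈ W} η m²·⟪d m, blockApply B W d m⟫` (coercivity applied to `η·d`, plus the commutator
`Σ η m (η n − η m)⟪d m, B m n d n⟫ ≤ Λ·Σ (η‖d‖)²`). [this file, g57] -/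
theorem weighted_coercive
    (hco : ∀ d : ℤ → E3, δ * ∑ m ∈ W, ‖d m‖ ^ 2 ≤ ∑ m ∈ W, ⟪d m, blockApply B W d m⟫_ℝ)
    {η : ℤ → ℝ} {θ : ℕ → ℝ} (hη : ∀ m, 0 < η m) (hθ : ∀ m n : ℤ, |η m - η n| ≤ θ (m - n).natAbs * η n)
    (hrow : ∀ m ∈ W, ∑ n ∈ W, θ (m - n).natAbs * ‖B m n‖ ≤ Λ) (hcol : ∀ n ∈ W, ∑ m ∈ W, θ (m - n).natAbs * ‖B m n‖ ≤ Λ)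
    (d : ℤ → E3) :
    (δ - Λ) * ∑ m ∈ W, (η m * ‖d m‖) ^ 2 ≤ ∑ m ∈ W, η m ^ 2 * ⟪d m, blockApply B W d m⟫_ℝ := by
  set a : ℤ → ℝ := fun m => η m * ‖d m‖ with ha
  set I : ℤ → ℤ → ℝ := fun m n => ⟪d m, B m n (d n)⟫_ℝ with hI
  have hE : δ * ∑ m ∈ W, a m ^ 2 ≤ ∑ m ∈ W, ∑ n ∈ W, η m * η n * I m n := by
    have h := hco (fun m => η m • d m)
    have h1 : ∀ m, ‖η m • d m‖ ^ 2 = a m ^ 2 := fun m => by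
      rw [norm_smul, Real.norm_of_nonneg (hη m).le]
    have h2 : ∀ m, ⟪η m • d m, blockApply B W (fun n => η n • d n) m⟫_ℝ = ∑ n ∈ W, η m * η n * I m n := fun m => by
      rw [blockApply, inner_sum]
      refine sum_congr rfl fun n _ => ?_
      rw [map_smul, real_inner_smul_left, real_inner_smul_right, mul_assoc]
    simp only [h1, h2] at h
    exact h
  have hS : ∑ m ∈ W, η m ^ 2 * ⟪d m, blockApply B W d m⟫_ℝ = ∑ m ∈ W, ∑ n ∈ W, η m ^ 2 * I m n := by
    refine sum_congr rfl fun m _ => ?_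
    rw [blockApply, inner_sum, mul_sum]
  have hterm : ∀ m ∈ W, ∀ n ∈ W,
      η m * η n * I m n - η m ^ 2 * I m n ≤ θ (m - n).natAbs * ‖B m n‖ * ((a m ^ 2 + a n ^ 2) / 2) := by
    intro m _ n _
    have hIle : |I m n| ≤ ‖d m‖ * (‖B m n‖ * ‖d n‖) :=
      (abs_real_inner_le_norm _ _).trans (mul_le_mul_of_nonneg_left (ContinuousLinearMap.le_opNorm _ _) (norm_nonneg _))
    have h' : |η n - η m| ≤ θ (m - n).natAbs * η n := by
      rw [abs_sub_comm]
      exact hθ m n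
    have hθη : 0 ≤ θ (m - n).natAbs * η n := (abs_nonneg _).trans h'
    have hθnn : 0 ≤ θ (m - n).natAbs := le_of_mul_le_mul_right (by rwa [zero_mul]) (hη n)
    have hdiff : η m * η n * I m n - η m ^ 2 * I m n = η m * ((η n - η m) * I m n) := by ring
    rw [hdiff]
    calc η m * ((η n - η m) * I m n) ≤ η m * |(η n - η m) * I m n| := mul_le_mul_of_nonneg_left (le_abs_self _) (hη m).le
      _ = η m * (|η n - η m| * |I m n|) := by rw [abs_mul]
      _ ≤ η m * (θ (m - n).natAbs * η n * (‖d m‖ * (‖B m n‖ * ‖d n‖))) :=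
          mul_le_mul_of_nonneg_left (mul_le_mul h' hIle (abs_nonneg _) hθη) (hη m).le
      _ = θ (m - n).natAbs * ‖B m n‖ * (a m * a n) := by
          simp only [ha]
          ring
      _ ≤ θ (m - n).natAbs * ‖B m n‖ * ((a m ^ 2 + a n ^ 2) / 2) :=
          mul_le_mul_of_nonneg_left (by nlinarith [sq_nonneg (a m - a n)]) (mul_nonneg hθnn (norm_nonneg _))
  have hC : ∑ m ∈ W, ∑ n ∈ W, η m * η n * I m n - ∑ m ∈ W, ∑ n ∈ W, η m ^ 2 * I m n ≤ Λ * ∑ m ∈ W, a m ^ 2 := by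
    have h1 : ∀ m n : ℤ, θ (m - n).natAbs * ‖B m n‖ * ((a m ^ 2 + a n ^ 2) / 2) =
        a m ^ 2 * (θ (m - n).natAbs * ‖B m n‖) / 2 + a n ^ 2 * (θ (m - n).natAbs * ‖B m n‖) / 2 := fun m n => by ring
    have hfirst : ∑ m ∈ W, ∑ n ∈ W, a m ^ 2 * (θ (m - n).natAbs * ‖B m n‖) / 2 =
        (∑ m ∈ W, a m ^ 2 * ∑ n ∈ W, θ (m - n).natAbs * ‖B m n‖) / 2 := by
      rw [sum_div]
      exact sum_congr rfl fun m _ => by rw [mul_sum, sum_div]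
    have hsecond : ∑ m ∈ W, ∑ n ∈ W, a n ^ 2 * (θ (m - n).natAbs * ‖B m n‖) / 2 =
        (∑ n ∈ W, a n ^ 2 * ∑ m ∈ W, θ (m - n).natAbs * ‖B m n‖) / 2 := by
      rw [sum_comm, sum_div]
      exact sum_congr rfl fun n _ => by rw [mul_sum, sum_div]
    have hA : ∑ m ∈ W, a m ^ 2 * ∑ n ∈ W, θ (m - n).natAbs * ‖B m n‖ ≤ ∑ m ∈ W, a m ^ 2 * Λ :=
      sum_le_sum fun m hm => mul_le_mul_of_nonneg_left (hrow m hm) (sq_nonneg _)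
    have hB : ∑ n ∈ W, a n ^ 2 * ∑ m ∈ W, θ (m - n).natAbs * ‖B m n‖ ≤ ∑ n ∈ W, a n ^ 2 * Λ :=
      sum_le_sum fun n hn => mul_le_mul_of_nonneg_left (hcol n hn) (sq_nonneg _)
    have hΛ : ∑ m ∈ W, a m ^ 2 * Λ = Λ * ∑ m ∈ W, a m ^ 2 := by rw [← sum_mul, mul_comm]
    rw [← sum_sub_distrib]
    calc ∑ m ∈ W, (∑ n ∈ W, η m * η n * I m n - ∑ n ∈ W, η m ^ 2 * I m n)
        = ∑ m ∈ W, ∑ n ∈ W, (η m * η n * I m n - η m ^ 2 * I m n) := by simp only [sum_sub_distrib]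
      _ ≤ ∑ m ∈ W, ∑ n ∈ W, θ (m - n).natAbs * ‖B m n‖ * ((a m ^ 2 + a n ^ 2) / 2) :=
          sum_le_sum fun m hm => sum_le_sum fun n hn => hterm m hm n hn
      _ = (∑ m ∈ W, a m ^ 2 * ∑ n ∈ W, θ (m - n).natAbs * ‖B m n‖) / 2 +
            (∑ n ∈ W, a n ^ 2 * ∑ m ∈ W, θ (m - n).natAbs * ‖B m n‖) / 2 := by
          simp only [h1, sum_add_distrib, hfirst, hsecond]
      _ ≤ (∑ m ∈ W, a m ^ 2 * Λ) / 2 + (∑ n ∈ W, a n ^ 2 * Λ) / 2 := by gcongr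
      _ = Λ * ∑ m ∈ W, a m ^ 2 := by rw [hΛ]; ring
  rw [hS]
  linarith [hE, hC]

end WindowInverse

end Summit.AtomisticToContinuum.Crystallization.Theorems.ChartedZeroExcessLayeredLatticeLiouville
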